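import Mathlib

-- val-idea-18: in-Lean cheapest falsifier (a) for line sing_height_cascade, branch R3.
-- Kernel-checked (`decide`) numerical witnesses used by the case tree of `Lines/sing_height_cascade.lean`:
--   det B(U,V) at two 0/1 points (branch R3: det B(a₀,a₁) ≢ 0 in char ≠ 2), and rank-2 STAR / K₂₂ sanity instances (branch R2).
-- HONEST FRAMING: arithmetic facts only; nothing of the crux, the rung or VP ≠ VNP is asserted.
def compound (u v : Fin 4 → ℤ) : Matrix (Fin 4) (Fin 4) ℤ :=
  Matrix.of fun j c => if j = c then 0 else
    ∑ e, ∑ f, if e ≠ j ∧ e ≠ c ∧ f ≠ j ∧ f ≠ c ∧ e ≠ f then u e * v f else 0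

theorem compound_val : compound ![0,1,1,1] ![1,0,1,1] =
    !![0, 2, 1, 1; 2, 0, 1, 1; 1, 1, 0, 1; 1, 1, 1, 0] := by
  decide

/-- det B((0,1,1,1),(1,0,1,1)) = -4: a power of 2 up to sign, hence nonzero in every characteristic ≠ 2. -/
theorem det_compound_witness : (compound ![0,1,1,1] ![1,0,1,1]).det = -4 := by
  decide

/-- det B(𝟙,𝟙) = -48. -/
theorem det_compound_ones : (compound ![1,1,1,1] ![1,1,1,1]).det = -48 := by
  decide

/-- principal 2×2 minors of a zero-diagonal symmetric matrix are −B_{jc}², so rank 1 is impossible; sanity instance: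
the adjugate of a rank-≤-2 STAR matrix vanishes while the matrix does not. -/
theorem star_adjugate_zero : (!![0, 1, 2, 3; 1, 0, 0, 0; 2, 0, 0, 0; 3, 0, 0, 0] : Matrix (Fin 4) (Fin 4) ℤ).adjugate = 0 := by
  decide

/-- and a K₂₂ matrix (support {0,1}×{2,3}) likewise has rank 2: adjugate zero. -/
theorem k22_adjugate_zero : (!![0, 0, 1, 2; 0, 0, 3, 6; 1, 3, 0, 0; 2, 6, 0, 0] : Matrix (Fin 4) (Fin 4) ℤ).adjugate = 0 := by
  decide
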